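import Summits.BirchSwinnertonDyer.Rank1Residual.Additive.RamifiedSevenGenusTowerLifts
import Summits.BirchSwinnertonDyer.Rank1Residual.Additive.RamifiedSevenMemberRealisation
import Literature.NumberTheory.IwasawaTheory.IwasawaAlgebraProjectiveLimit
import Literature.NumberTheory.IwasawaTheory.KubotaLeopoldtPowerSeries
import Literature.NumberTheory.EllipticCurves.Kato2004.KummerFrameOfTorsionTower
import Literature.NumberTheory.Congruences.BernoulliTeichmullerCongruence
import Literature.NumberTheory.GaussSums.JacobiSumTeichmullerIntegralQuadratic
import Literature.NumberTheory.QuadraticFields.JacobiCharacterInt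
import Literature.NumberTheory.QuadraticFields.JacobiCharacterPrimitiveProofs
import Literature.NumberTheory.EllipticCurves.Kato2004.LayerCharacterTwoProofs
import Mathlib.NumberTheory.GaussSum
import Mathlib.NumberTheory.Padics.HeightOneSpectrum
import HarnessLib

/-!
# K2C-14 (P1/4) — the ARITHMETIC INPUTS of a `𝒞₇` genus frame (`GenusSeven.GenusFrame`): generic kernels §A1–A4

Port (pen `bsd-cm` D1059) of the crux workfile `Cruxes/EllipticUnitValueSevenOfGZK/K2C14GenusFrameArithmeticInputs_g77.lean`
(commit e142b9ea3ae9, tree sha16 80281c1844350e71) by seat bsd-idea-20 g77; row K2C-14 (pen D1048).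

Cell bsd-cm, seat bsd-idea-20 g77 (planner, crux-level, W-79 publish-only), crux `EllipticUnitValueSevenOfGZK`
(stmt-BirchSwinnertonDyer-19945, route K7r `RamifiedSevenEllipticUnits`).  Specification = the K2C-11 inventory memo v3
`Cruxes/EllipticUnitValueSevenOfGZK/K2C11ConstructionInventory_g76.md` (tree 12ee9b0d407224ef) §1(b)/(c); row card
`pub/bsd-cm/bsd-cm-plan/g37/SUMMON-typers-K2C-13-16.md` (7e0dfdb9162e356c); pen rulings D1044 (C), D1045, D1048.

SPLIT (pen D1061; the tree's 400-line rule for files with proofs): the port is FOUR files with one namespace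
`Summit.BirchSwinnertonDyer.Rank1Residual.Additive.GenusSeven.ArithmeticInputs` and a linear import chain —
P1 `RamifiedSevenGenusFrameArithmeticKernels.lean` (§A1–A4), P2 `RamifiedSevenGenusFrameGaussSqrt.lean` (§A5),
P3 `RamifiedSevenGenusFrameArithmeticInputs.lean` (§B part 1: `v` … `ω`), P4 `RamifiedSevenGenusFrameArithmeticInputsEta.lean`
(§B part 2: `etaOne_isPrimitive`, `g`, `r`, `η₁`, the assembly check `mkGenusFrame`).  Content = commit e142b9ea3ae9 verbatim up to
the five D1059 edits (namespace, `set_option`, draft sentence) and this split.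

THIS PART (P1): §A GENERIC KERNELS (odd `p`; the three template-less ones of the memo first) — (A1)–(A4) here, (A5) in P2:
* (A1) `exists_pow_sub_mem_span_pow_of_isTopGenerator` — the powers of a topological generator `u` of `1 + pℤ_p`
  exhaust the principal units modulo `p^{n+1}`; (A2) `exists_isLogTable` — a `γ`-log table EXISTS for every such `u`
  and every Teichmüller `ω` (`IsLogTable p u ω r`, Lang Ch. 10 §1);
* (A3) `coeffSubring_ringHomComp_intAlgebraMap`, `exists_map_intAlgebraMap_eq` — the `ℤ_p`-descent of an integral
  Kubota–Leopoldt series of a `ℤ_p`-VALUED character; (A4) `exists_int_kubotaLeopoldtSeries` (under the displayed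
  named fact `hKL : iwasawa_existsUnique_kubotaLeopoldtSeries`, the ONLY fact binder of this file);

WHAT THIS FILE DOES.  For a discriminant `D` (`D < 0`, `D ≡ 1 (mod 4)`, squarefree, `7 ∤ D`) it CONSTRUCTS / PROVES, one
declaration per field and in the EXACT letter of the field (`RamifiedSevenGenusFactorisationShape.lean` l.101–157), every
field of `GenusSeven.GenusFrame` between `v` (l.113) and `r_logTable` (l.154) — i.e. everything except the road data
`D, normA` (parameters) and the semi-local datum `U` (l.156–157, row K2C-13 ★).  Namespace
`Summit.BirchSwinnertonDyer.Rank1Residual.Additive.GenusSeven.ArithmeticInputs`.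

FINDINGS (boxed for the pen; none is a letter deviation):
  ┌ (F1) `hKL`.  `g`/`g_spec` are the only declarations under the named fact `iwasawa_existsUnique_kubotaLeopoldtSeries`
  │      (row card: «displayed hypothesis hKL»); `genusFrameOf … (hKL) …` must thread it.  Everything else is unconditional.
  │ (F2) `[NeZero D.natAbs]`.  `χD`, `zetaLevel/ζsys`, `etaOne/galToPow/η₁`, `g` carry the instance binder (Mathlib's
  │      `jacobiCharInt`/`DirichletCharacter` API wants it); at the frame constructor: `haveI := ⟨Int.natAbs_ne_zero.mpr hD.ne⟩`.
  │      The field `g_spec : ∀ [NeZero D.natAbs], …` is then `g_spec D hKL hD4 hsq h7` (instances of a `Prop`-class agree).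
  │ (F3) ℚ-ALGEBRA DIAMOND on `ℚ̄`.  A freshly elaborated `ℚ̄ ≃ₐ[ℚ] ℚ̄` / `IntermediateField ℚ ℚ̄` picks Mathlib's
  │      `DivisionRing.toRatAlgebra`, while `absoluteGaloisGroup.toAlgEquiv ℚ σ` lands at `AlgebraicClosure.instAlgebra ℚ`; the two
  │      are DEFINITIONALLY equal but not at `instances` transparency: pass between them with `exact`/`Eq.trans`, never `rw`
  │      (see `η₁_trivial`, χ_D-part).  No statement is affected.
  │ (F4) `MulChar.ofUnitHom (f ^ n) = MulChar.ofUnitHom f ^ n` (`ofUnitHom_pow`) is not in Mathlib; 3 lines here.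
  └ (F5) `u = 64`, `χ₇(σ₈) = 8`, `γ₀ = σ₈²` exactly as the row card; `σ₈` is CHOSEN (surjectivity of `χ₇` + prime-to-7
         splitting, `Classical.choose`), so `γ₀`, `u`, `r`, `g` are noncomputable but closed terms.

HONEST LABEL: infrastructure (definitions + kernel lemmas); it closes no item, registers no stub, proves no summit
statement; stmt-BirchSwinnertonDyer-19945 is OPEN; `X12.CMRamifiedSeven` is NOT proved; BSD is claimed for no curve.
No `sorry`, no `instance`, no `notation`/`macro`, no named fact introduced, no attribute removed.

References: [Lang1990] S. Lang, Cyclotomic Fields I and II, Ch. 10 §1 (PDF p. 167: `γ`, `⟨a⟩ = γ^{α(a)}`, `r(a)`);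
[Tsuji1999] T. Tsuji, Semi-local units modulo cyclotomic units, J. Number Theory 78 (1999), §3–§4; [Washington1997]
L. Washington, Introduction to Cyclotomic Fields, Ch. 3–4 (conductors; Gauss sums, Lemma 4.7–4.8), Ch. 14 (p. 321);
[IrelandRosen1990] K. Ireland, M. Rosen, A Classical Introduction to Modern Number Theory, Ch. 6 §3 (the sign of the
quadratic Gauss sum squared, `g² = (−1)^{(p−1)/2} p`) and Ch. 13 §3; [Kato2004Asterisque] K. Kato, Astérisque 295, §15.5.
-/

noncomputable section

open scoped NumberField
open PowerSeries IsDedekindDomain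
open Literature.NumberTheory.EllipticCurves
open Literature.NumberTheory.EllipticCurves.IwasawaAlgebra
open Literature.NumberTheory.IwasawaTheory
open Literature.NumberTheory.IwasawaTheory.StickelbergerSeries
open Literature.NumberTheory.ComplexMultiplication.EllipticUnits

namespace Summit.BirchSwinnertonDyer.Rank1Residual.Additive.GenusSeven.ArithmeticInputs

/-! ## §A1 The powers of a topological generator exhaust `1 + pℤ_p` modulo `p^{n+1}` (Lang Ch. 10 §1) -/

section TopGenerator

variable {p : ℕ} [Fact p.Prime]

/-- An element `t ≡ 1 (mod p)` of `ℤ_p` is a unit. [cite: Lang1990, Ch. 10 §1 (PDF p. 167, «1 + pℤ_p»)] -/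
theorem isUnit_of_sub_one_mem_span {t : ℤ_[p]} (ht : t - 1 ∈ Ideal.span {(p : ℤ_[p])}) : IsUnit t := by
  rcases IsLocalRing.isUnit_or_isUnit_one_sub_self t with h | h
  · exact h
  · exfalso
    have hmem : 1 - t ∈ IsLocalRing.maximalIdeal ℤ_[p] := by
      rw [PadicInt.maximalIdeal_eq_span_p, ← Ideal.neg_mem_iff, neg_sub]; exact ht
    exact ((IsLocalRing.mem_maximalIdeal _).mp hmem) h

/-- The image of a unit of `ℤ_p` in `(ℤ/p^{n+1})^×`. [cite: Lang1990, Ch. 10 §1 (PDF p. 167)] -/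
def unitMod (n : ℕ) {x : ℤ_[p]} (hx : IsUnit x) : (ZMod (p ^ (n + 1)))ˣ :=
  Units.map (PadicInt.toZModPow (n + 1) : ℤ_[p] →+* ZMod (p ^ (n + 1))).toMonoidHom hx.unit

/-- The underlying residue of `unitMod`. [cite: Lang1990, Ch. 10 §1 (PDF p. 167)] -/
theorem coe_unitMod (n : ℕ) {x : ℤ_[p]} (hx : IsUnit x) :
    ((unitMod n hx : (ZMod (p ^ (n + 1)))ˣ) : ZMod (p ^ (n + 1))) = PadicInt.toZModPow (n + 1) x := by
  simp [unitMod]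

/-- `unitMod n hx` reduces to `1` modulo `p` iff `x ≡ 1 (mod p)`. [cite: Lang1990, Ch. 10 §1 (PDF p. 167)] -/
theorem unitsMap_unitMod_eq_one_iff (n : ℕ) {x : ℤ_[p]} (hx : IsUnit x) :
    ZMod.unitsMap (pow_dvd_pow p (Nat.le_add_left 1 n)) (unitMod n hx) = 1 ↔
      x - 1 ∈ Ideal.span {(p : ℤ_[p])} := by
  rw [← Units.val_eq_one, ZMod.unitsMap_val, coe_unitMod, PadicInt.cast_toZModPow 1 (n + 1) (Nat.le_add_left 1 n),
    ← map_one (PadicInt.toZModPow 1), ← RingHom.sub_mem_ker_iff, PadicInt.ker_toZModPow, pow_one]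

/-- **The powers of a topological generator `u` of `1 + pℤ_p` (`p` odd) exhaust `1 + pℤ_p` modulo `p^{n+1}`**: for every
`t ≡ 1 (mod p)` there is `k` with `u^k ≡ t (mod p^{n+1})` — the subgroup generated by `u` in the kernel of
`(ℤ/p^{n+1})^× → (ℤ/p)^×` (order `pⁿ`) has order `≥ pⁿ` by the tree's `IsTopGenerator.prime_pow_dvd_of_pow_sub_one_mem`
(`u^k ≡ 1 ⇒ pⁿ ∣ k`), hence is the whole kernel (Lang: «`⟨a⟩ = γ^{α(a)}`»). [cite: Lang1990, Ch. 10 §1 (PDF p. 167) and Thm. 1.2 (PDF p. 168)] -/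
theorem exists_pow_sub_mem_span_pow_of_isTopGenerator (hp : p ≠ 2) {u : ℤ_[p]} (hu : KubotaLeopoldt.IsTopGenerator p u)
    {t : ℤ_[p]} (ht : t - 1 ∈ Ideal.span {(p : ℤ_[p])}) (n : ℕ) :
    ∃ k : ℕ, u ^ k - t ∈ Ideal.span {(p : ℤ_[p]) ^ (n + 1)} := by
  classical
  have hpr : p.Prime := Fact.out
  haveI : NeZero (p ^ (n + 1)) := ⟨pow_ne_zero _ hpr.ne_zero⟩
  haveI : NeZero (p ^ 1) := ⟨pow_ne_zero _ hpr.ne_zero⟩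
  have huU : IsUnit u := hu.isUnit
  have htU : IsUnit t := isUnit_of_sub_one_mem_span ht
  have hu1 : u - 1 ∈ Ideal.span {(p : ℤ_[p])} := by
    rw [← pow_one (p : ℤ_[p]), ← PadicInt.norm_le_pow_iff_mem_span_pow, hu]; simp
  set ū : (ZMod (p ^ (n + 1)))ˣ := unitMod n huU with hūdef
  set tū : (ZMod (p ^ (n + 1)))ˣ := unitMod n htU with htūdef
  set φ : (ZMod (p ^ (n + 1)))ˣ →* (ZMod (p ^ 1))ˣ := ZMod.unitsMap (pow_dvd_pow p (Nat.le_add_left 1 n)) with hφ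
  have hūker : ū ∈ φ.ker := (MonoidHom.mem_ker).mpr ((unitsMap_unitMod_eq_one_iff n huU).mpr hu1)
  have htker : tū ∈ φ.ker := (MonoidHom.mem_ker).mpr ((unitsMap_unitMod_eq_one_iff n htU).mpr ht)
  -- `#ker φ = pⁿ`
  have hsurj : Function.Surjective φ := ZMod.unitsMap_surjective _
  have hindex : φ.ker.index = p - 1 := by
    rw [Subgroup.index_ker, MonoidHom.range_eq_top.mpr hsurj, Subgroup.card_top, Nat.card_eq_fintype_card,
      ZMod.card_units_eq_totient, Nat.totient_prime_pow_succ hpr, pow_zero, one_mul]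
  have hcardG : Nat.card (ZMod (p ^ (n + 1)))ˣ = p ^ n * (p - 1) := by
    rw [Nat.card_eq_fintype_card, ZMod.card_units_eq_totient, Nat.totient_prime_pow_succ hpr]
  have hcardK : Nat.card φ.ker = p ^ n := by
    have h := Subgroup.card_mul_index φ.ker
    rw [hindex, hcardG] at h
    exact Nat.eq_of_mul_eq_mul_right (by have := hpr.two_le; omega) h
  -- `pⁿ ≤ orderOf ū`
  have hord : p ^ n ≤ orderOf ū := by
    have h1 : ((ū ^ orderOf ū : (ZMod (p ^ (n + 1)))ˣ) : ZMod (p ^ (n + 1))) = 1 := by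
      rw [pow_orderOf_eq_one, Units.val_one]
    rw [Units.val_pow_eq_pow_val, hūdef, coe_unitMod, ← map_pow, ← map_one (PadicInt.toZModPow (n + 1)),
      ← RingHom.sub_mem_ker_iff, PadicInt.ker_toZModPow] at h1
    exact Nat.le_of_dvd (orderOf_pos ū) (KubotaLeopoldt.IsTopGenerator.prime_pow_dvd_of_pow_sub_one_mem p hp hu h1)
  -- hence `⟨ū⟩ = ker φ ∋ tū`
  have hle : Subgroup.zpowers ū ≤ φ.ker := (Subgroup.zpowers_le).mpr hūker
  have heq : Subgroup.zpowers ū = φ.ker :=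
    Subgroup.eq_of_le_of_card_ge hle (by rw [hcardK, Nat.card_zpowers]; exact hord)
  have htmem : tū ∈ Submonoid.powers ū :=
    ((isOfFinOrder_of_finite ū).mem_powers_iff_mem_zpowers).mpr (heq ▸ htker)
  obtain ⟨k, hk⟩ := (Submonoid.mem_powers_iff _ _).mp htmem
  refine ⟨k, ?_⟩
  have hk' := congrArg (fun z : (ZMod (p ^ (n + 1)))ˣ => (z : ZMod (p ^ (n + 1)))) hk
  simp only [Units.val_pow_eq_pow_val, hūdef, htūdef, coe_unitMod, ← map_pow] at hk'
  rw [← PadicInt.ker_toZModPow, RingHom.sub_mem_ker_iff]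
  exact hk'

/-! ## §A2 A `γ`-log table exists (`IsLogTable p u ω r`, any odd `p`, any top generator `u`, Teichmüller `ω`) -/

/-- **Existence of a `γ`-log table** (memo §1(b) row «`r` 153 / `r_logTable` 154»; Lang Ch. 10 §1 «`a = ω(a)⟨a⟩`,
`⟨a⟩ = γ^{α(a)}`, `r(a) ≡ α(a) mod pⁿ`»): for `p` odd, `u` a topological generator of `1 + pℤ_p` and `ω` the
(`ℤ_p`-valued) Teichmüller character there is `r : ℕ → ℕ → ℕ` with `u^{r n a}·ω(a) ≡ a (mod p^{n+1})` for all `a`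
prime to `p` — by (A1) at `t = a·ω(a)⁻¹ ≡ 1 (mod p)`.  Stated at the generality of `IsLogTable` (pen D1048 (ii)).
[cite: Lang1990, Ch. 10 §1 (PDF p. 167) and Thm. 1.2 (PDF p. 168)] -/
theorem exists_isLogTable (hp : p ≠ 2) {u : ℤ_[p]} (hu : KubotaLeopoldt.IsTopGenerator p u)
    {ω : DirichletCharacter ℤ_[p] p} (hω : IsTeichmullerCharacter p ω) :
    ∃ r : ℕ → ℕ → ℕ, IsLogTable p u ω r := by
  classical
  have key : ∀ n a : ℕ, a.Coprime p →
      ∃ k : ℕ, u ^ k * ω (a : ZMod p) - (a : ℤ_[p]) ∈ Ideal.span {(p : ℤ_[p]) ^ (n + 1)} := by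
    intro n a ha
    let aU : (ZMod p)ˣ := ZMod.unitOfCoprime a ha
    have haU : (aU : ZMod p) = a := ZMod.coe_unitOfCoprime a ha
    set w : ℤ_[p]ˣ := MulChar.toUnitHom ω aU with hw
    have hωa : ω (a : ZMod p) = (w : ℤ_[p]) := by rw [← haU, hw, MulChar.coe_toUnitHom]
    have hwmod : PadicInt.toZMod (w : ℤ_[p]) = (aU : ZMod p) := by rw [← hωa, ← haU]; exact hω aU
    -- `t = a·w⁻¹ ≡ 1 (mod p)`
    have ht : (a : ℤ_[p]) * ((w⁻¹ : ℤ_[p]ˣ) : ℤ_[p]) - 1 ∈ Ideal.span {(p : ℤ_[p])} := by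
      rw [← PadicInt.maximalIdeal_eq_span_p, ← PadicInt.ker_toZMod, RingHom.sub_mem_ker_iff, map_mul, map_one,
        map_natCast]
      have h2 : PadicInt.toZMod ((w⁻¹ : ℤ_[p]ˣ) : ℤ_[p]) * PadicInt.toZMod (w : ℤ_[p]) = 1 := by
        rw [← map_mul, Units.inv_mul, map_one]
      rw [← haU, ← hwmod, mul_comm]
      exact h2
    obtain ⟨k, hk⟩ := exists_pow_sub_mem_span_pow_of_isTopGenerator hp hu ht n
    refine ⟨k, ?_⟩
    have e : u ^ k * ω (a : ZMod p) - (a : ℤ_[p]) =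
        (w : ℤ_[p]) * (u ^ k - (a : ℤ_[p]) * ((w⁻¹ : ℤ_[p]ˣ) : ℤ_[p])) := by
      rw [hωa, mul_sub, ← mul_assoc, mul_comm (w : ℤ_[p]) (a : ℤ_[p]), mul_assoc, Units.mul_inv, mul_one, mul_comm]
    rw [e]
    exact Ideal.mul_mem_left _ _ hk
  choose! r hr using key
  exact ⟨r, fun n a ha => hr n a ha⟩

end TopGenerator

/-! ## §A3 `ℤ_p`-descent of integral series of a `ℤ_p`-valued character (memo §1(c)) -/

section Descent

variable {p : ℕ} [Fact p.Prime] {f : ℕ}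

/-- `intAlgebraMap p : ℤ_p → ℂ_p` is injective (it is isometric, `KubotaLeopoldt.norm_intAlgebraMap`); the `p = 7`
instance is `GenusSeven.intAlgebraMap_injective` (GenusResidue). [cite: Lang1990, Ch. 10 §1 (PDF p. 167, `𝔬 ⊂ ℂ_p`)] -/
theorem intAlgebraMap_injective (p : ℕ) [Fact p.Prime] : Function.Injective (KubotaLeopoldt.intAlgebraMap p) := by
  refine (injective_iff_map_eq_zero _).mpr fun x hx => ?_
  have h := KubotaLeopoldt.norm_intAlgebraMap p x
  rw [hx, norm_zero] at h
  exact norm_eq_zero.mp h.symm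

/-- **For a `ℤ_p`-VALUED character the coefficient ring `ℤ_p[ψ] ⊆ ℂ_p` is (the image of) `ℤ_p`** (Tsuji p. 1
«the ring generated by the values of `χ` over `ℤ_p`» — here the values already lie in `ℤ_p`). [cite: Tsuji1999, §1 p. 1 and §4 Definition p. 12] -/
theorem coeffSubring_ringHomComp_intAlgebraMap (ψ : DirichletCharacter ℤ_[p] f) :
    KubotaLeopoldt.coeffSubring p (ψ.ringHomComp (KubotaLeopoldt.intAlgebraMap p)) =
      (KubotaLeopoldt.intAlgebraMap p).range := by
  apply le_antisymm
  · refine Subring.closure_le.mpr ?_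
    rintro x (⟨z, rfl⟩ | ⟨a, rfl⟩)
    · exact ⟨z, rfl⟩
    · exact ⟨ψ a, rfl⟩
  · rintro x ⟨z, rfl⟩
    exact KubotaLeopoldt.intAlgebraMap_mem_coeffSubring p _ z

/-- **`ℤ_p`-descent**: a series integral for a `ℤ_p`-valued character is the image of a series over `ℤ_p`
(coefficientwise). [cite: Tsuji1999, §4 Definition p. 12 («`g_χ(T) ∈ ℤ_p[χ][[T]]`»)] -/
theorem exists_map_intAlgebraMap_eq (ψ : DirichletCharacter ℤ_[p] f) {g : PowerSeries ℂ_[p]}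
    (hg : KubotaLeopoldt.IsIntegral p (ψ.ringHomComp (KubotaLeopoldt.intAlgebraMap p)) g) :
    ∃ g₀ : PowerSeries ℤ_[p], PowerSeries.map (KubotaLeopoldt.intAlgebraMap p) g₀ = g := by
  classical
  have h : ∀ n : ℕ, ∃ c : ℤ_[p], KubotaLeopoldt.intAlgebraMap p c = PowerSeries.coeff n g := fun n => by
    have hn := hg n
    rw [coeffSubring_ringHomComp_intAlgebraMap] at hn
    exact hn
  choose c hc using h
  refine ⟨PowerSeries.mk c, ?_⟩
  ext n
  rw [PowerSeries.coeff_map, PowerSeries.coeff_mk, hc]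

/-! ## §A4 The `ℤ_p`-coefficient Kubota–Leopoldt series of a `ℤ_p`-valued primitive character (memo §1(c) rows «g», «g_spec») -/

/-- **Under Iwasawa's existence fact** (`hKL`, displayed; Tsuji p. 6, Thm. 4.3) a primitive `ℤ_p`-VALUED `ψ` mod `f`
(`p ∤ f`, `(f, i) ≠ (1, 0)`, `i ≤ p − 2`) has a Kubota–Leopoldt series WITH COEFFICIENTS IN `ℤ_p`:
existence in `ℂ_p⟦T⟧` with coefficients in `ℤ_p[ψ] = ℤ_p` (A3), then descent. [cite: Tsuji1999, p. 6 L17–21 and §4 Thm. 4.3 (pp. 12–13)] [cite: Lang1990, Ch. 10 §2 (PDF p. 171)] -/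
theorem exists_int_kubotaLeopoldtSeries (hKL : iwasawa_existsUnique_kubotaLeopoldtSeries) (hp : p ≠ 2)
    [NeZero f] (hf : f.Coprime p) {ψ : DirichletCharacter ℤ_[p] f} (hψ : ψ.IsPrimitive) {i : ℕ} (hi : i ≤ p - 2)
    (hχ : ¬ (f = 1 ∧ i = 0)) {u : ℤ_[p]} (hu : KubotaLeopoldt.IsTopGenerator p u) :
    ∃ g₀ : PowerSeries ℤ_[p],
      IsKubotaLeopoldtSeries p (ψ.ringHomComp (KubotaLeopoldt.intAlgebraMap p)) i u
        (PowerSeries.map (KubotaLeopoldt.intAlgebraMap p) g₀) := by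
  have hψ' : DirichletCharacter.IsPrimitive (ψ.ringHomComp (KubotaLeopoldt.intAlgebraMap p)) :=
    (Kato2004.LayerCharacterTwo.isPrimitive_ringHomComp_iff ψ (intAlgebraMap_injective p)).mpr hψ
  obtain ⟨g, hgint, hg⟩ := exists_kubotaLeopoldtSeries hKL hp hf hψ' hi hχ hu
  obtain ⟨g₀, rfl⟩ := exists_map_intAlgebraMap_eq ψ hgint
  exact ⟨g₀, hg⟩

end Descent

end Summit.BirchSwinnertonDyer.Rank1Residual.Additive.GenusSeven.ArithmeticInputs

end
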